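import Summits.MatrixMultiplication.OmegaCensus.STPPSmallPatternLawBridge

/-!
# ω-census, small STPP patterns: the seed bridge on an ORDER WINDOW with an EXCEPTION LIST (generic)

HONEST FRAMING (pub-omega census; verbatim): lottery ticket; floor = certified bounds/negative ranges.
Census STRUCTURE tool of the STPP track (seat pub-omega-stpp-3, gen 28; STRUCTURE row B5 / §2 C10), not progress on `ω`.

The all-type host laws «every finite abelian group of order `≥ N` hosts `(1,2,2)^k`» (`…T2K12Law`, `…T2K13Law`, `…T2K14N290Law`) land at the
least threshold `N` above every seed type without a known family, which can exceed ENG2's cyclic ray start `R` (`k = 13`: `N = 276 > R = 252`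
because of the single type `ℤ/11 × ℤ/5 × ℤ/5`; `k = 14`: `290 > 284` because of `ℤ/17 × ℤ/17` and `ℤ/9 × (ℤ/2)⁵`).  This file adds the generic
step that turns such a law into «order `≥ R`, EXCEPT the groups containing a copy of one of the listed exception types»:

* `prod_le_prod_of_le_of_one_le` — a sub-multiset of a multiset of positive naturals has no larger product;
* `exists_seed_emb_of_core_window` — the minimal-form seed bridge `exists_seed_emb_of_core_min` on the ORDER WINDOW `N ≤ |G| ≤ N'`: the kernel
  core is only asked for minimal capped multisets with `N ≤ M.prod ≤ N'` (the minimal sub-multiset extracted from the capped factor multiset of `G`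
  has product `≤ |G| ≤ N'`);
* `exists_isSTPP_cards_of_core_window` — the same followed by the dispatch «every seed of the window list either hosts the pattern or is one of
  the exception types `X`», for groups `G` into which NO exception type embeds (an exception seed dominated by the factor multiset would embed).

No definition is introduced; `P`, `N`, `N'`, `Emax`, `CL`, `L`, `X` are arbitrary.  The per-`k` window laws (`…T2K13W252Law`, …) combine this with
the landed law above `N'` and the cyclic ray for exponent `≥ R`.

References: H. Cohn, R. Kleinberg, B. Szegedy, C. Umans, FOCS 2005 (arXiv:math/0511460), Def. 5.1 (tree `IsSTPP`); the structure theorem is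
Mathlib's `AddCommGroup.equiv_directSum_zmod_of_finite`.
-/

open Literature.Computability.AlgebraicComplexity Finset

namespace Summit.MatrixMultiplication.OmegaCensus

/-- A sub-multiset of a multiset of positive naturals has no larger product. [folklore] -/
theorem prod_le_prod_of_le_of_one_le {M' M : Multiset ℕ} (h : M' ≤ M) (hpos : ∀ a ∈ M, 1 ≤ a) : M'.prod ≤ M.prod :=
  Nat.le_of_dvd (Multiset.prod_pos fun a ha => hpos a ha) (Multiset.prod_dvd_prod_of_le h)

/-- **GENERIC SEED BRIDGE ON AN ORDER WINDOW (minimal form).** As `exists_seed_emb_of_core_min`, for groups of order `N ≤ |G| ≤ N'`: the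
domination core is only required for minimal capped multisets with `N ≤ M.prod ≤ N'`. [folklore] -/
theorem exists_seed_emb_of_core_window (P : ℕ → Prop) {N N' Emax : ℕ} (CL : ℕ → List (ℕ × ℕ)) {L : List (List ℕ)}
    (hcap : ∀ E ∈ List.range' 1 Emax, ∀ p k : ℕ, p.Prime → P p → 0 < k → p ^ k ∣ E →
      N ≤ (p ^ k) ^ Multiset.count (p ^ k) (capMS (CL E)))
    (hcore : ∀ E ∈ List.range' 1 Emax, ∀ M ∈ subMS (CL E), N ≤ M.prod → M.prod ≤ N' → (∀ x ∈ M, M.prod < N * x) →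
      ∃ s ∈ L, dom s M = true)
    {G : Type*} [AddCommGroup G] [Finite G] (hP : ∀ p : ℕ, p.Prime → p ∣ Nat.card G → P p)
    (hexp : AddMonoid.exponent G ≤ Emax) (hG : N ≤ Nat.card G) (hG' : Nat.card G ≤ N') :
    ∃ s ∈ L, ∃ φ : SeedType s →+ G, Function.Injective φ := by
  classical
  obtain ⟨ι, _, p, hp, e, ⟨g⟩⟩ := AddCommGroup.equiv_directSum_zmod_of_finite G
  let f : G ≃+ (Π i, ZMod (p i ^ e i)) :=
    g.trans (DirectSum.linearEquivFunOnFintype ℕ ι (fun i => ZMod (p i ^ e i))).toAddEquiv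
  have hE1 : 1 ≤ AddMonoid.exponent G := Nat.pos_of_ne_zero AddMonoid.exponent_ne_zero_of_finite
  have hdvd : ∀ i, p i ^ e i ∣ AddMonoid.exponent G := fun i => by
    have hinj : Function.Injective (AddMonoidHom.single (fun j => ZMod (p j ^ e j)) i) :=
      Pi.single_injective (M := fun j => ZMod (p j ^ e j)) i
    have h1 : addOrderOf (f.symm (AddMonoidHom.single (fun j => ZMod (p j ^ e j)) i 1)) = p i ^ e i := by
      rw [AddEquiv.addOrderOf_eq, addOrderOf_injective _ hinj, ZMod.addOrderOf_one]
    rw [← h1]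
    exact AddMonoid.addOrder_dvd_exponent _
  have hq0 : ∀ i, p i ^ e i ≠ 0 := fun i => pow_ne_zero _ (hp i).ne_zero
  set M : Multiset ℕ := (Finset.univ.filter fun i => 0 < e i).val.map fun i => p i ^ e i with hM
  have hprodeq : M.prod = ∏ i, p i ^ e i := by
    rw [hM, ← Finset.prod_eq_multiset_prod]
    exact Finset.prod_filter_of_ne fun i _ hi => Nat.pos_of_ne_zero fun h0 => hi (by rw [h0, pow_zero])
  have hcardeq : Nat.card G = ∏ i, p i ^ e i := by
    rw [Nat.card_congr f.toEquiv, Nat.card_pi]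
    simp [Nat.card_zmod]
  have hEI : AddMonoid.exponent G ∈ List.range' 1 Emax := List.mem_range'_1.2 ⟨hE1, by omega⟩
  set C := capMS (CL (AddMonoid.exponent G)) with hC
  have hprodN : N ≤ M.prod := by rw [hprodeq, ← hcardeq]; exact hG
  have hmemM : ∀ a ∈ M, ∃ i, 0 < e i ∧ a = p i ^ e i := by
    intro a ha
    obtain ⟨i, hi, rfl⟩ := Multiset.mem_map.1 ha
    exact ⟨i, (Finset.mem_filter.1 hi).2, rfl⟩
  have hpos : ∀ a ∈ M, 1 ≤ a := by
    intro a ha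
    obtain ⟨i, hi, rfl⟩ := hmemM a ha
    exact Nat.one_le_iff_ne_zero.2 (hq0 i)
  have hcapM : ∀ a ∈ M, N ≤ a ^ Multiset.count a C := by
    intro a ha
    obtain ⟨i, hi, rfl⟩ := hmemM a ha
    have hPi : P (p i) := hP (p i) (hp i) (by
      rw [hcardeq]
      exact dvd_trans (dvd_pow_self (p i) hi.ne') (Finset.dvd_prod_of_mem _ (Finset.mem_univ i)))
    exact hcap _ hEI (p i) (e i) (hp i) hPi hi (hdvd i)
  have hcapd := prod_inter_ge_of (C := C) hprodN hpos hcapM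
  obtain ⟨M', hM'le, hM'N, hM'min⟩ := exists_le_minimal_prod_ge N (M ∩ C) hcapd
  have hM'M : M' ≤ M := hM'le.trans Multiset.inter_le_left
  have hM'N' : M'.prod ≤ N' :=
    le_trans (prod_le_prod_of_le_of_one_le hM'M hpos) (by rw [hprodeq, ← hcardeq]; exact hG')
  have hsub : M' ∈ subMS (CL (AddMonoid.exponent G)) := mem_subMS_of_le _ _ (hM'le.trans Multiset.inter_le_right)
  obtain ⟨s, hs, hD⟩ := hcore _ hEI M' hsub hM'N hM'N' hM'min
  obtain ⟨φ, hφ, -⟩ := exists_emb_of_dom (fun i => p i ^ e i) hq0 s _ (dom_mono s hM'M hD)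
  exact ⟨s, hs, f.symm.toAddMonoidHom.comp φ, f.symm.injective.comp hφ⟩

/-- **GENERIC ORDER-LAW STEP ON A WINDOW WITH EXCEPTIONS.** Under the hypotheses of `exists_seed_emb_of_core_window`, if every seed type of the
window list `L` either belongs to the exception list `X` or hosts an STPP family of size pattern `(a, b, c)^k`, then every finite abelian group with
prime divisors in `P`, exponent `≤ Emax`, order in `[N, N']`, and admitting NO embedding of an exception type, hosts such a family.
[cite: CohnKleinbergSzegedyUmans2005, Def. 5.1] -/
theorem exists_isSTPP_cards_of_core_window (P : ℕ → Prop) {N N' Emax k a b c : ℕ} (CL : ℕ → List (ℕ × ℕ)) {L : List (List ℕ)}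
    (X : List (List ℕ))
    (hcap : ∀ E ∈ List.range' 1 Emax, ∀ p j : ℕ, p.Prime → P p → 0 < j → p ^ j ∣ E →
      N ≤ (p ^ j) ^ Multiset.count (p ^ j) (capMS (CL E)))
    (hcore : ∀ E ∈ List.range' 1 Emax, ∀ M ∈ subMS (CL E), N ≤ M.prod → M.prod ≤ N' → (∀ x ∈ M, M.prod < N * x) →
      ∃ s ∈ L, dom s M = true)
    (hL : ∀ s ∈ L, s ∈ X ∨
      ∃ A B C : Fin k → Finset (SeedType s), IsSTPP A B C ∧ ∀ i, (A i).card = a ∧ (B i).card = b ∧ (C i).card = c)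
    {G : Type*} [AddCommGroup G] [Finite G] (hP : ∀ p : ℕ, p.Prime → p ∣ Nat.card G → P p)
    (hexp : AddMonoid.exponent G ≤ Emax) (hG : N ≤ Nat.card G) (hG' : Nat.card G ≤ N')
    (hX : ∀ s ∈ X, ∀ φ : SeedType s →+ G, ¬ Function.Injective φ) :
    ∃ A B C : Fin k → Finset G, IsSTPP A B C ∧ ∀ i, (A i).card = a ∧ (B i).card = b ∧ (C i).card = c := by
  obtain ⟨s, hs, φ, hφ⟩ := exists_seed_emb_of_core_window P CL hcap hcore hP hexp hG hG'
  rcases hL s hs with hsX | hhost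
  · exact absurd hφ (hX s hsX φ)
  · exact exists_isSTPP_cards_of_injective φ hφ hhost

/-- An additive hom from a finite group of larger order is never injective (used to discharge the exception hypothesis from an order bound).
[folklore] -/
theorem not_injective_of_card_lt {H G : Type*} [AddCommGroup H] [AddCommGroup G] [Finite H] [Finite G]
    (h : Nat.card G < Nat.card H) (φ : H →+ G) : ¬ Function.Injective φ := fun hφ =>
  absurd (Nat.card_le_card_of_injective φ hφ) (not_le.2 h)

/-- An additive hom from a finite group whose order does not divide the order of the target is never injective. [folklore] -/
theorem not_injective_of_not_dvd {H G : Type*} [AddCommGroup H] [AddCommGroup G] [Finite H] [Finite G]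
    (h : ¬ Nat.card H ∣ Nat.card G) (φ : H →+ G) : ¬ Function.Injective φ := fun hφ => by
  classical
  apply h
  have := AddSubgroup.card_addSubgroup_dvd_card φ.range
  rwa [Nat.card_congr (φ.ofInjective hφ).toEquiv.symm] at this

end Summit.MatrixMultiplication.OmegaCensus
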